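import Literature.AlgebraicGeometry.HodgeTheory.ProjectionFromVertexHomology
import Literature.AlgebraicGeometry.Motives.ProjectiveSpaceFieldPointsBijective
import Literature.AlgebraicGeometry.Motives.AlgPointsSeparate
import HarnessLib

/-!
# The projection from the vertex on complex points: `[u₀ : ⋯ : u_{d+1}] ↦ [u₀ : ⋯ : u_d]`

Family `hodge`, layer `Literature/AlgebraicGeometry/HodgeTheory`. PROOF FILE (theorems only; no
definition, no named fact). The linear projection from the vertex `(0 : … : 0 : 1)` of `ℙ^{d+1}_ℂ`
(de Jong 1996, proof of Lemma 4.11; the tree's `DeJong1996.vertexProjection`, over `ℂ` as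
`vertexProjectionOver d : puncturedOver d ⟶ ℙ^d`, `HodgeTheory/ProjectionFromVertexHomology`) is
constructed chart by chart from generating sections; this file READS IT ON COMPLEX POINTS in the
homogeneous coordinates `ProjectiveSpace.pointOfVec` of `Motives/ProjectiveSpaceFieldPoints`:

* `pt_pointOfVec_eq_vertex_iff` — `[u]` is the vertex iff `u₀ = ⋯ = u_d = 0`;
* `map_vertexProjectionOver_eq_pointOfVec` — **for a complex point `P` of `ℙ^{d+1} ∖ {vertex}` with
  coordinates `[u]`, `pr(P) = [u₀ : ⋯ : u_d]`** (on the chart `D₊(x_i)`, `u_i ≠ 0`, `pr` is `Spec`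
  of `y_a/y_i ↦ x_a/x_i`, `DeJong1996.chartToPunctured_comp_vertexProjection`, and evaluation at
  `u` after that ring map is evaluation at `(u₀, …, u_d)`);
* `map_puncturedOverι_hyperplaneToPunctured` — the witness `ℙ^d ≅ V₊(x_{d+1}) ↪ ℙ^{d+1} ∖ {vertex}`
  is `[y] ↦ [y : 0]`;
* `hyperplaneToPunctured_comp_vertexProjectionOver` — **`ℙ^d ≅ V₊(x_{d+1}) → ℙ^{d+1} ∖ {vertex} → ℙ^d`
  is the identity** (complex points separate morphisms of varieties,
  `SchemeOver.hom_ext_of_forall_algPoints`).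

## References

* [DeJong1996] A. J. de Jong, Smoothness, semi-stability and alterations, Publ. Math. IHÉS 83
  (1996), proof of Lemma 4.11, p. 68.
* [Hartshorne1977] R. Hartshorne, Algebraic Geometry, GTM 52, II Thm. 7.1, II Ex. 2.14.
-/

noncomputable section

open CategoryTheory AlgebraicGeometry HomogeneousLocalization MvPolynomial
open Literature.AlgebraicGeometry.Motives Literature.AlgebraicGeometry.Resolution

attribute [local instance] MvPolynomial.gradedAlgebra ProjBaseChange.algebraBase

namespace Literature.AlgebraicGeometry.HodgeTheory

section HodgeTheory

variable (d : ℕ)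

/-! ### The vertex in homogeneous coordinates -/

/-- **`[u]` is the vertex `(0 : … : 0 : 1)` iff `u₀ = ⋯ = u_d = 0`** (the vertex misses every
`D₊(x_i)`, `i ≤ d`, and is the only point off `⋃_{i ≤ d} D₊(x_i)`; `[u] ∈ D₊(x_i) ↔ u_i ≠ 0`).
[cite: DeJong1996, Lemma 4.11 (proof), p. 68] -/
theorem pt_pointOfVec_eq_vertex_iff (u : Fin (d + 1 + 1) → ℂ) (hu : u ≠ 0) :
    (ProjectiveSpace.pointOfVec ℂ u hu).pt = DeJong1996.vertex d ℂ ↔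
      ∀ i : Fin (d + 1), u (Fin.castSucc i) = 0 := by
  constructor
  · intro h i
    by_contra hi
    have hmem : (ProjectiveSpace.pointOfVec ℂ u hu).pt ∈
        Proj.basicOpen (MvPolynomial.homogeneousSubmodule (Fin (d + 1 + 1)) ℂ)
          (X (Fin.castSucc i)) :=
      (ProjectiveSpace.pt_pointOfVec_mem_basicOpen_X_iff u hu (Fin.castSucc i)).2 hi
    rw [h] at hmem
    exact DeJong1996.vertex_notMem_basicOpen d ℂ i hmem
  · intro h
    by_contra hne
    have hmem : (ProjectiveSpace.pointOfVec ℂ u hu).pt ∈ DeJong1996.puncturedSpace d ℂ :=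
      (DeJong1996.mem_puncturedSpace_iff d ℂ _).2 hne
    obtain ⟨i, hi⟩ := TopologicalSpace.Opens.mem_iSup.mp hmem
    exact (ProjectiveSpace.pt_pointOfVec_mem_basicOpen_X_iff u hu (Fin.castSucc i)).1 hi (h i)

/-- Off the vertex, `(u₀, …, u_d) ≠ 0`. [folklore] -/
theorem comp_castSucc_ne_zero_of_ne_vertex (u : Fin (d + 1 + 1) → ℂ) (hu : u ≠ 0)
    (h : (ProjectiveSpace.pointOfVec ℂ u hu).pt ≠ DeJong1996.vertex d ℂ) :
    (u ∘ Fin.castSucc : Fin (d + 1) → ℂ) ≠ 0 := by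
  intro h0
  exact h ((pt_pointOfVec_eq_vertex_iff d u hu).2 fun i ↦ congrFun h0 i)

/-! ### The projection from the vertex on complex points -/

/-- Evaluation at `u` on the chart ring `(ℂ[x]_{(x_i)})₀` after `y_a/y_i ↦ x_a/x_i` is evaluation at
`(u₀, …, u_d)` on `(ℂ[y]_{(y_i)})₀`. [folklore] -/
theorem awayEval_comp_vertexProjectionRingHom (u : Fin (d + 1 + 1) → ℂ) (i : Fin (d + 1))
    (hui : aeval u (X (Fin.castSucc i) : MvPolynomial (Fin (d + 1 + 1)) ℂ) ≠ 0)
    (hvi : aeval (u ∘ Fin.castSucc) (X i : MvPolynomial (Fin (d + 1)) ℂ) ≠ 0) :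
    (ProjectiveSpace.awayEval u hui).toRingHom.comp (DeJong1996.vertexProjectionRingHom d ℂ i) =
      (ProjectiveSpace.awayEval (u ∘ Fin.castSucc) hvi).toRingHom := by
  apply DeJong1996.awayRingHom_ext ℂ
  · rw [RingHom.comp_assoc, DeJong1996.vertexProjectionRingHom_comp_cst]
    ext c
    change ProjectiveSpace.awayEval u hui (Segre.cst ℂ _ c) =
      ProjectiveSpace.awayEval (u ∘ Fin.castSucc) hvi (Segre.cst ℂ _ c)
    have h1 : Segre.cst ℂ (X (Fin.castSucc i) : MvPolynomial (Fin (d + 1 + 1)) ℂ) c =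
        algebraMap ℂ _ c := rfl
    have h2 : Segre.cst ℂ (X i : MvPolynomial (Fin (d + 1)) ℂ) c = algebraMap ℂ _ c := rfl
    rw [h1, h2, AlgHom.commutes, AlgHom.commutes]
  · intro a
    rw [RingHom.comp_apply, DeJong1996.vertexProjectionRingHom_frac]
    change ProjectiveSpace.awayEval u hui (Segre.frac ℂ (Fin.castSucc i) (Fin.castSucc a)) =
      ProjectiveSpace.awayEval (u ∘ Fin.castSucc) hvi (Segre.frac ℂ i a)
    rw [Segre.frac, Away.isLocalizationElem, ProjectiveSpace.awayEval_mk u hui (Segre.X_mem ℂ _),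
      Segre.frac, Away.isLocalizationElem,
      ProjectiveSpace.awayEval_mk (u ∘ Fin.castSucc) hvi (Segre.X_mem ℂ _)]
    simp only [pow_one, aeval_X, Function.comp_apply]

/-- **The projection from the vertex on complex points**: if the complex point `P` of
`ℙ^{d+1} ∖ {vertex}` has homogeneous coordinates `[u₀ : ⋯ : u_{d+1}]`, then `pr(P) = [u₀ : ⋯ : u_d]`
(read on the chart `D₊(x_i)`, `u_i ≠ 0`, where `pr` is `Spec` of `y_a/y_i ↦ x_a/x_i`).
[cite: DeJong1996, Lemma 4.11 (proof), p. 68] [cite: Hartshorne1977, II Thm. 7.1] -/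
theorem map_vertexProjectionOver_eq_pointOfVec (P : ComplexPoints (puncturedOver d))
    (u : Fin (d + 1 + 1) → ℂ) (hu : u ≠ 0)
    (hP : AlgPoints.map (puncturedOverι d) P = ProjectiveSpace.pointOfVec ℂ u hu)
    (hu' : (u ∘ Fin.castSucc : Fin (d + 1) → ℂ) ≠ 0) :
    AlgPoints.map (vertexProjectionOver d) P =
      ProjectiveSpace.pointOfVec ℂ (u ∘ Fin.castSucc) hu' := by
  obtain ⟨i, hi⟩ := Function.ne_iff.mp hu'
  have hui : aeval u (X (Fin.castSucc i) : MvPolynomial (Fin (d + 1 + 1)) ℂ) ≠ 0 := by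
    rwa [aeval_X]
  have hvi : aeval (u ∘ Fin.castSucc) (X i : MvPolynomial (Fin (d + 1)) ℂ) ≠ 0 := by
    rwa [aeval_X]
  -- work with the underlying morphism `Spec ℂ → ℙ^{d+1} ∖ {vertex}` at its plain type
  obtain ⟨Pl, hPl0⟩ : ∃ Pl : Spec (.of ℂ) ⟶ (DeJong1996.puncturedSpace d ℂ : Scheme), Pl = P.left :=
    ⟨_, rfl⟩
  have ha : Pl ≫ (DeJong1996.puncturedSpace d ℂ).ι =
      Spec.map (CommRingCat.ofHom (ProjectiveSpace.awayEval u hui).toRingHom) ≫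
        Segre.chartι ℂ (Fin.castSucc i) := by
    have h1 : Pl ≫ (DeJong1996.puncturedSpace d ℂ).ι = (AlgPoints.map (puncturedOverι d) P).left := by
      rw [hPl0]; rfl
    rw [h1, hP, ProjectiveSpace.pointOfVec_eq_chartPoint u hu (Segre.X_mem ℂ (Fin.castSucc i))
      one_pos hui, ProjectiveSpace.chartPoint_left]
  -- `P` factors through the chart `D₊(x_i) ↪ ℙ^{d+1} ∖ {vertex}`
  have hb : Pl = Spec.map (CommRingCat.ofHom (ProjectiveSpace.awayEval u hui).toRingHom) ≫
      DeJong1996.chartToPunctured d ℂ i :=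
    (cancel_mono (DeJong1996.puncturedSpace d ℂ).ι).mp (by
      rw [Category.assoc, DeJong1996.chartToPunctured_ι]; exact ha)
  -- so `pr(P)` is the chart point of `(u₀, …, u_d)` through `D₊(y_i)`
  have hq : (AlgPoints.map (vertexProjectionOver d) P).left =
      Spec.map (CommRingCat.ofHom (ProjectiveSpace.awayEval (u ∘ Fin.castSucc) hvi).toRingHom) ≫
        Segre.chartι ℂ i := by
    have hc : (AlgPoints.map (vertexProjectionOver d) P).left = Pl ≫ DeJong1996.vertexProjection d ℂ := by
      rw [hPl0]; rfl
    rw [hc, hb, Category.assoc, DeJong1996.chartToPunctured_comp_vertexProjection,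
      DeJong1996.vertexProjectionChart, ← Category.assoc, ← Spec.map_comp, ← CommRingCat.ofHom_comp,
      awayEval_comp_vertexProjectionRingHom d u i hui hvi]
  ext : 1
  rw [hq, ProjectiveSpace.pointOfVec_eq_chartPoint (u ∘ Fin.castSucc) hu' (Segre.X_mem ℂ i) one_pos hvi,
    ProjectiveSpace.chartPoint_left]

/-- Every complex point of `ℙ^{d+1} ∖ {vertex}` has homogeneous coordinates `[u]` with
`(u₀, …, u_d) ≠ 0`. [folklore] -/
theorem exists_map_puncturedOverι_eq (P : ComplexPoints (puncturedOver d)) :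
    ∃ (u : Fin (d + 1 + 1) → ℂ) (hu : u ≠ 0),
      AlgPoints.map (puncturedOverι d) P = ProjectiveSpace.pointOfVec ℂ u hu ∧
        (u ∘ Fin.castSucc : Fin (d + 1) → ℂ) ≠ 0 := by
  obtain ⟨u, hu, h⟩ := ProjectiveSpace.exists_eq_pointOfVec (AlgPoints.map (puncturedOverι d) P)
  refine ⟨u, hu, h, comp_castSucc_ne_zero_of_ne_vertex d u hu ?_⟩
  rw [← h, AlgPoints.pt_map]
  have hmem : (puncturedOverι d).left.base P.pt ∈ DeJong1996.puncturedSpace d ℂ := by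
    change (DeJong1996.puncturedSpace d ℂ).ι.base P.pt ∈ DeJong1996.puncturedSpace d ℂ
    rw [Scheme.Opens.ι_apply]
    exact P.pt.2
  exact (DeJong1996.mem_puncturedSpace_iff d ℂ _).1 hmem

/-! ### The coordinate hyperplane `V₊(x_{d+1})` and `pr` -/

/-- `ℙ^d ≅ V₊(x_{d+1}) ↪ ℙ^{d+1} ∖ {vertex} ↪ ℙ^{d+1}` is the coordinate embedding `skipMap`. [folklore] -/
theorem hyperplaneToPunctured_comp_puncturedOverι :
    hyperplaneToPunctured d ≫ puncturedOverι d = ProjectiveSpace.skipMap (k := ℂ) (Fin.last (d + 1)) := by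
  ext : 1
  rw [Over.comp_left]
  exact hyperplaneToPunctured₀_ι d

/-- **On complex points `ℙ^d ≅ V₊(x_{d+1}) ↪ ℙ^{d+1} ∖ {vertex}` is `[y] ↦ [y : 0]`.** [folklore] -/
theorem map_puncturedOverι_hyperplaneToPunctured (y : Fin (d + 1) → ℂ) (hy : y ≠ 0) :
    AlgPoints.map (puncturedOverι d) (AlgPoints.map (hyperplaneToPunctured d)
        (ProjectiveSpace.pointOfVec ℂ y hy)) =
      ProjectiveSpace.pointOfVec ℂ (ProjectiveSpace.insertZero (Fin.last (d + 1)) y)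
        (ProjectiveSpace.insertZero_ne_zero (Fin.last (d + 1)) hy) := by
  rw [← AlgPoints.map_comp_apply, hyperplaneToPunctured_comp_puncturedOverι, AlgPoints.map_apply]
  exact ProjectiveSpace.pointOfVec_comp_skipMap (Fin.last (d + 1)) y hy

/-- `(y : 0)` with the last coordinate dropped is `y`. [folklore] -/
theorem insertZero_last_comp_castSucc (y : Fin (d + 1) → ℂ) :
    (ProjectiveSpace.insertZero (Fin.last (d + 1)) y ∘ Fin.castSucc : Fin (d + 1) → ℂ) = y := by
  funext j
  rw [Function.comp_apply, ← Fin.succAbove_last, ProjectiveSpace.insertZero_succAbove]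

/-- **`ℙ^d ≅ V₊(x_{d+1}) → ℙ^{d+1} ∖ {vertex} → ℙ^d` is the identity**: both sides agree on every
complex point (`[y] ↦ [y : 0] ↦ [y]`), and complex points separate morphisms from a reduced
`ℂ`-scheme of finite type to a separated one (`SchemeOver.hom_ext_of_forall_algPoints`).
[cite: DeJong1996, Lemma 4.11 (proof), p. 68] [cite: Hartshorne1977, II Thm. 7.1] -/
theorem hyperplaneToPunctured_comp_vertexProjectionOver :
    hyperplaneToPunctured d ≫ vertexProjectionOver d = 𝟙 (projectiveSpace d ℂ) := by
  have hP : IsSmoothProjective d (projectiveSpace d ℂ) := isSmoothProjective_projectiveSpace' d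
  haveI : LocallyOfFiniteType (projectiveSpace d ℂ).hom := locallyOfFiniteType_of_isSmoothProjective hP
  haveI : IsIntegral (projectiveSpace d ℂ).left := IsSmoothProjective.isIntegral_holds hP
  haveI : IsProper (projectiveSpace d ℂ).hom := IsSmoothProjective.isProper_holds hP
  refine SchemeOver.hom_ext_of_forall_algPoints ℂ fun Q ↦ ?_
  obtain ⟨y, hy, rfl⟩ := ProjectiveSpace.exists_eq_pointOfVec Q
  change AlgPoints.map (hyperplaneToPunctured d ≫ vertexProjectionOver d) (ProjectiveSpace.pointOfVec ℂ y hy) =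
    AlgPoints.map (𝟙 _) (ProjectiveSpace.pointOfVec ℂ y hy)
  rw [AlgPoints.map_comp_apply, AlgPoints.map_id_apply,
    map_vertexProjectionOver_eq_pointOfVec d _ _ _ (map_puncturedOverι_hyperplaneToPunctured d y hy)
      (by rw [insertZero_last_comp_castSucc]; exact hy)]
  congr 1
  exact insertZero_last_comp_castSucc d y

end HodgeTheory

end Literature.AlgebraicGeometry.HodgeTheory

end
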